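import Literature.AlgebraicGeometry.AbelianSchemes.AbelianSchemeOverGlueDataPolarizationOfReduced
import Literature.AlgebraicGeometry.AbelianSchemes.AbelianSchemeDualPairNormalize
import HarnessLib

/-!
# Gluing polarised triples along a cocycle of the base with NO unit hypotheses: renormalise the dual pair of the glued
# family (capstone of hand (h7)(D-F3))

Topic `AlgebraicGeometry/AbelianSchemes`; namespaces `…AbelianSchemeOver.ZariskiGluingDatum.PolarizationChartDatum` and
`…AbelianSchemeOver.CocycleDatum`.  Cell hodgecm-mathlib (D-0151), hand (h7)(D-F3), consumer F-8 (8c).  THEOREMS ONLY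
(no def, no instance, no notation, no `sorry`).

★ FILE F `AbelianSchemeOverGlueDataPolarizationOfReduced` leaves ONE binder in the gluing of polarised triples along a
cocycle of a reduced locally Noetherian base: `unit₀ : 𝒫₀|_{Z × {ε_Ẑ}} ≅ 𝒪`, the normalisation of the Poincaré sheaf of
the chosen dual pair `D₀ = (Ẑ, 𝒫₀)` of the glued family along `Z × {ε_Ẑ}`.  ★ `AbelianSchemeDualPairNormalize` shows
that every dual pair renormalises: `D₀.normalize = (Ẑ, 𝒫₀ ⊗ (pr_Z^*(𝒫₀|_{Z × {ε_Ẑ}}))^∨)` is a dual pair with the SAME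
`Ẑ` and `𝒫|_{Z × {ε_Ẑ}} ≅ 𝒪` (★ `nonempty_unitHatSlice_iso_normalize`; [MumfordFogartyKirwan1994, Ch. 6 §2 p. 121]:
the normalised Poincaré sheaf).  Hence, for ANY dual pair `D₀` of the glued family:

* §1 (`ZariskiGluingDatum.PolarizationChartDatum`) `hĜ_normalize_of_isReduced_of_isLocallyNoetherian`,
  `pol_lam_left_comp_Ĝ_normalize_of_isReduced` — the charts of duals into `D₀.normalize` and the glued polarisation
  w.r.t. `D₀.normalize` over a reduced locally Noetherian base, hypothesis-free;
* §2 (`CocycleDatum`) `pol_lam_left_comp_Ĝ_normalize`, **`isBaseChangeVia_chartTriple_normalize`** — the glued triple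
  `𝔊.glueTriple … D₀.normalize … (D₀.nonempty_unitHatSlice_iso_normalize) (𝔊.unit_of_isReduced Dc pol)` over reduced
  locally Noetherian slices and its CARTESIAN CHARTS (all five clauses of ★ `PolarizedAbelianSchemeWithLevel.IsBaseChangeVia`),
  from slice triples + transition isos + ANY dual pair of the glued family.  This is the F-8 (8c) recipe's gluing step
  with every auxiliary hypothesis discharged; what F-8 proper must still supply is the `CocycleDatum` of the universal
  family over the slices `V_R` with its transition isomorphisms of triples, and F-3 a dual pair of the glued family.

HC_CM is proved only modulo the printed citations until rung 0 closes; this file discharges none of them.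

## References
* [MumfordFogartyKirwan1994] D. Mumford, J. Fogarty, F. Kirwan, *Geometric Invariant Theory*, 3rd ed. (1994), Ch. 6 §1
  Cor. 6.8 (p. 118), §2 (p. 121); Ch. 7 §2 Def. 7.2 (p. 129), Def. 7.3 (p. 129).
* [MilneAV2008] J. S. Milne, *Abelian Varieties* (v2.00, 2008), I §8 pp. 36–37.
* [StacksProject] The Stacks Project, Tag 01LH (Relative glueing).
-/

universe u

open CategoryTheory CategoryTheory.Limits AlgebraicGeometry MonoidalCategory

noncomputable section

namespace Literature.AlgebraicGeometry.AbelianSchemes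

namespace AbelianSchemeOver

open scoped MonObj

variable {S : Scheme.{u}}

/-! ### §1 Over a Zariski gluing datum -/

namespace ZariskiGluingDatum

namespace PolarizationChartDatum

variable {𝔇 : ZariskiGluingDatum S} (𝔔 : PolarizationChartDatum 𝔇) (D₀ : 𝔇.abelianScheme.DualPair)

/-- **`hĜ` into the renormalised dual pair, hypothesis-free over a reduced locally Noetherian base** (★ FILE F
`hĜ_of_isReduced_of_isLocallyNoetherian` with `unit₀ := D₀.nonempty_unitHatSlice_iso_normalize`).
[cite: MumfordFogartyKirwan1994, Ch. 6 §1 Cor. 6.8 (p. 118) and §2 (p. 121)] [cite: MilneAV2008, I §8 pp. 36–37] -/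
theorem hĜ_normalize_of_isReduced_of_isLocallyNoetherian [IsReduced S] [IsLocallyNoetherian S] (i : 𝔇.𝒰.I₀) :
    (𝔔.Dc i).hat.IsBaseChangeVia D₀.normalize.hat (𝔇.𝒰.f i) (𝔔.Ĝ D₀.normalize i) :=
  𝔔.hĜ_of_isReduced_of_isLocallyNoetherian D₀.normalize D₀.nonempty_unitHatSlice_iso_normalize i

/-- **The chart clause of the glued polarisation w.r.t. `D₀.normalize`, hypothesis-free over a reduced locally Noetherian
base**: `λᵢ ≫ Ĝᵢ = χᵢ ≫ λ`. [cite: MumfordFogartyKirwan1994, Ch. 7 §2 Definition 7.2 (p. 129)] -/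
theorem pol_lam_left_comp_Ĝ_normalize_of_isReduced [IsReduced S] [IsLocallyNoetherian S] (i : 𝔇.𝒰.I₀) :
    (𝔔.pol i).lam.left ≫ 𝔔.Ĝ D₀.normalize i =
      𝔇.χ i ≫ (𝔔.toPolarizationDatum D₀.normalize
        (𝔔.hĜ_normalize_of_isReduced_of_isLocallyNoetherian D₀)).polarization.lam.left :=
  𝔔.pol_lam_left_comp_Ĝ D₀.normalize (𝔔.hĜ_normalize_of_isReduced_of_isLocallyNoetherian D₀) i

end PolarizationChartDatum

end ZariskiGluingDatum

/-! ### §2 Over a cocycle of the base: the glued triple for ANY dual pair of the glued family -/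

namespace CocycleDatum

open Literature.AlgebraicGeometry.ModuliOfAbelianVarieties (IsPolarizationType)

variable {D : Scheme.GlueData.{u}} (𝔊 : CocycleDatum D) (Dc : ∀ i, (𝔊.A i).DualPair)
  (pol : ∀ i, (𝔊.A i).Polarization (Dc i))
  (θhat : ∀ i j, ((Dc i).baseChange (D.f i j)).hat.X.left ⟶ ((Dc j).baseChange (D.f j i)).hat.X.left)
  (hθhat : ∀ i j, ∃ (wG : ((𝔊.A i).baseChange (D.f i j)).X.hom ≫ D.t i j =
      𝔊.θ i j ≫ ((𝔊.A j).baseChange (D.f j i)).X.hom)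
    (wĜ : ((Dc i).baseChange (D.f i j)).hat.X.hom ≫ D.t i j = θhat i j ≫ ((Dc j).baseChange (D.f j i)).hat.X.hom),
    Nonempty ((Scheme.Modules.pullback (pullback.map ((𝔊.A i).baseChange (D.f i j)).X.hom
      ((Dc i).baseChange (D.f i j)).hat.X.hom ((𝔊.A j).baseChange (D.f j i)).X.hom
      ((Dc j).baseChange (D.f j i)).hat.X.hom (𝔊.θ i j) (θhat i j) (D.t i j) wG wĜ)).obj
        ((Dc j).baseChange (D.f j i)).P ≅ ((Dc i).baseChange (D.f i j)).P))
  (hlam : ∀ i j, ((pol i).baseChange (D.f i j)).lam.left ≫ θhat i j =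
    𝔊.θ i j ≫ ((pol j).baseChange (D.f j i)).lam.left)
  (D₀ : 𝔊.abelianScheme.DualPair) {g N : ℕ} {δ : Fin g → ℕ} (φ : ∀ i, (𝔊.A i).LevelStructure g N)
  (hφ : ∀ i j, ((φ i).baseChange (D.f i j)).IsBaseChangeVia ((φ j).baseChange (D.f j i)) (D.t i j) (𝔊.θ i j))
  (hrel : ∀ i, (𝔊.A i).IsOfRelDim g) (hδ : IsPolarizationType δ) (hT : ∀ i, (pol i).HasType δ)
  (hsym : ∀ i, (φ i).IsSymplecticLiftable (pol i) δ) [∀ i, IsLocallyNoetherian (D.U i)] [∀ i, IsReduced (D.U i)]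

/-- **Every slice polarisation is the restriction of the glued one w.r.t. `D₀.normalize`** (★ FILE F on the renormalised
pair; no unit hypothesis). [cite: MumfordFogartyKirwan1994, Ch. 7 §2 Definition 7.2 (p. 129)] -/
theorem pol_lam_left_comp_Ĝ_normalize (i : D.J) :
    (pol i).lam.left ≫ 𝔊.Ĝ Dc pol θhat hθhat hlam D₀.normalize i =
      𝔊.total.ι i ≫ (𝔊.polarization Dc pol θhat hθhat hlam D₀.normalize D₀.nonempty_unitHatSlice_iso_normalize
        (𝔊.unit_of_isReduced Dc pol)).lam.left :=
  𝔊.pol_lam_left_comp_Ĝ_of_isReduced Dc pol θhat hθhat hlam D₀.normalize D₀.nonempty_unitHatSlice_iso_normalize i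

/-- **CARTESIAN CHARTS, NO UNIT HYPOTHESES**: for ANY dual pair `D₀` of the glued family, every slice triple is the
pull-back along `Uᵢ ↪ A⁰` of the glued triple
`𝔊.glueTriple … D₀.normalize … D₀.nonempty_unitHatSlice_iso_normalize (𝔊.unit_of_isReduced Dc pol)` over reduced locally
Noetherian slices (all five clauses of ★ `PolarizedAbelianSchemeWithLevel.IsBaseChangeVia`; ★ FILE F
`isBaseChangeVia_chartTriple_of_isReduced` on ★ `DualPair.normalize`). [cite: MumfordFogartyKirwan1994, Ch. 7 §2 Definition 7.2 (p. 129)]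
[cite: MumfordFogartyKirwan1994, Ch. 6 §2 (p. 121)] [cite: StacksProject, Tag 01LH] -/
theorem isBaseChangeVia_chartTriple_normalize (i : D.J) :
    (𝔊.chartTriple Dc pol φ hrel hT hsym (𝔊.unit_of_isReduced Dc pol) i).IsBaseChangeVia
      (𝔊.glueTriple Dc pol θhat hθhat hlam D₀.normalize φ hφ hrel hδ hT hsym D₀.nonempty_unitHatSlice_iso_normalize
        (𝔊.unit_of_isReduced Dc pol)) (D.ι i) (𝔊.total.ι i) (𝔊.Ĝ Dc pol θhat hθhat hlam D₀.normalize i) :=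
  𝔊.isBaseChangeVia_chartTriple_of_isReduced Dc pol θhat hθhat hlam D₀.normalize φ hφ hrel hδ hT hsym
    D₀.nonempty_unitHatSlice_iso_normalize i

/-- The dual pair of that glued triple is `D₀.normalize`, whose dual abelian scheme is the given `Ẑ` (definitional).
[cite: MumfordFogartyKirwan1994, Ch. 6 §1 Cor. 6.8 (p. 118)] -/
theorem glueTriple_normalize_D_hat :
    (𝔊.glueTriple Dc pol θhat hθhat hlam D₀.normalize φ hφ hrel hδ hT hsym D₀.nonempty_unitHatSlice_iso_normalize
      (𝔊.unit_of_isReduced Dc pol)).D.hat = D₀.hat := rfl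

end CocycleDatum

end AbelianSchemeOver

end Literature.AlgebraicGeometry.AbelianSchemes

end
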